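import Mathlib
import Literature.Probability.Percolation.UniquenessZone
import Literature.Probability.Percolation.UniversalTightness
import Literature.Probability.Percolation.InfiniteClusterDensity
import Literature.Probability.Percolation.CriticalContinuity
import Summits.CriticalPhenomena.PercolationContinuityZ3.Theses.PercNonProliferation

/-!
# Sketch — crux-ideate stmt-CriticalPhenomena-4445 (FreeBoxSparse), round 1, ideator 3

First lemmas of the two crux idea cards, stated over existing declarations (elaboration check
only; nothing is proved here).  Crux (route decl, FIXED):
`Summit.CriticalPhenomena.PercolationContinuityZ3.Theses.PercNonProliferation.FreeBoxSparse`
= `|Λ_n|⁻² Σ_{x,y ∈ Λ_n} P_{p_c}(x ↔ y inside Λ_n) → 0`, `Λ_n = box 3 n`.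

Tree objects used: `uniqZone k n` (UniquenessZone.lean: all clusters of the configuration
restricted to `Λ_n` joining `Λ_k` to `∂Λ_n` coincide), `armAt r x`, `armCount r B`
(InfiniteClusterDensity.lean), `typicalMax`/`clusterMaxIn` conventions (UniversalTightness.lean),
`openConnIn`, `bondPercolation`, `criticalProbI`, `box`, `innerBoundary`.
-/

namespace Summit.CriticalPhenomena.PercolationContinuityZ3.Cruxes.FreeBoxSparse.Sketch

open Literature.Probability.Percolation Literature.Probability.LatticeModels
open scoped BigOperators Classical
open Filter

noncomputable section

/-- The bond measure on `ℤ³` at parameter `p`, and the critical one. -/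
abbrev μ (p : unitInterval) : MeasureTheory.Measure (BondConfig (Site 3)) :=
  bondPercolation (zdGraph 3) p
abbrev μc : MeasureTheory.Measure (BondConfig (Site 3)) := μ (criticalProbI 3)

/-- The crux, by name. -/
abbrev Crux : Prop :=
  Summit.CriticalPhenomena.PercolationContinuityZ3.Theses.PercNonProliferation.FreeBoxSparse

/-! ## Card A — two-spanning-sublinear-hegemony -/

/-- **(A, target form C⁺) TwoSpanningSublinear (H∞).**  For every `c > 0` there is ONE aspect
ratio `1/ε` such that, eventually in `n`, the probability that the critical annulus
`A(εn, n)` is crossed by TWO distinct clusters of `Λ_n` (i.e. the complement of the tree's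
uniqueness zone `uniqZone ⌊εn⌋ n`) is at most `c·ε`.  Numerically `≍ ε^{ζ₂}`, `ζ₂ ≈ 1.86 > 1`
(two-cluster repulsion); BK alone gives only `ε^{2β/ν} = ε^{0.95}`.  False for `d > 6`. -/
def TwoSpanningSublinear : Prop :=
  ∀ c : ℝ, 0 < c → ∃ ε : ℝ, 0 < ε ∧ ε ≤ 1 / 4 ∧
    ∀ᶠ n : ℕ in atTop, (μc).real (uniqZone (d := 3) ⌊ε * n⌋₊ n)ᶜ ≤ c * ε

/-- The one-aspect, one-constant form handed to provers once the absolute constant `c⋆`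
(grid isoperimetry × dependent-percolation threshold) is fixed by the line. -/
def TwoSpanningAtOneAspect (cStar : ℝ) : Prop :=
  ∃ ε : ℝ, 0 < ε ∧ ε ≤ 1 / 4 ∧
    ∀ᶠ n : ℕ in atTop, (μc).real (uniqZone (d := 3) ⌊ε * n⌋₊ n)ᶜ ≤ cStar * ε

/-- **The hegemonic block event** `Heg(n, r)`: some vertex `x` of `Λ_{2n}` is joined INSIDE
`Λ_{2n}` to at least `4/5` of the `r`-arm points of `Λ_n` (the points `v ∈ Λ_n` with
`v ↔ v + ∂B(r+1)`, counted by the tree's `armCount r (box 3 n)`).  In the jump world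
`θ(p_c) > 0` these arm points are, up to a `(θ_r − θ)/θ`-fraction, the trace of the infinite
cluster; Card A shows `TwoSpanningSublinear ∧ θ(p_c) > 0 ⇒ P_{p_c}(Heg(n,r)) → 1`. -/
def Hegemonic (n r : ℕ) : Set (BondConfig (Site 3)) :=
  {ω | ∃ x ∈ box 3 (2 * n),
      (4 : ℝ) / 5 * (armCount r (box 3 n) ω : ℝ) ≤
        (((box 3 n).filter fun v =>
            ω ∈ armAt r v ∧ ω ∈ openConnIn (↑(box 3 (2 * n)) : Set (Site 3)) x v).card : ℝ)}

/-- **(A1, the jump-world step).**  Sublinear two-cluster crossing + a jump force hegemonic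
blocks with high probability at `p_c` (grid of `εn`-boxes, Markov + grid isoperimetry on the
bad sites, chaining of the unique crossing clusters through shared infinite-cluster points of
overlapping small boxes). -/
def CardA_step1 : Prop :=
  TwoSpanningSublinear → 0 < theta (zdGraph 3) (0 : Site 3) (criticalProbI 3) →
    ∃ r : ℕ, Tendsto (fun n : ℕ => (μc).real (Hegemonic n r)) atTop (nhds 1)

/-- **(A2, the subcritical step, provable now).**  Hegemonic blocks with probability close to
one at SOME parameter force percolation at that parameter (static renormalisation: adjacent
hegemonic clusters of half-overlapping blocks share an arm point by PIGEONHOLE on `armCount`,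
equidistributed by Chebyshev once `n ≥ n₀(r, a)` where `a` lower-bounds the arm density;
`5`-dependent good-block field; Liggett–Schonmann–Stacey / the tree's DST dependent-percolation
fact).  `δ₀` is the dependent-percolation threshold; `n₀` is uniform over all `p` with
`P_p(armAt r 0) ≥ a`, which is what the composition A3 needs (it is applied at `p = p_c − η`
with `η` found AFTER `n`). -/
def CardA_step2 : Prop :=
  ∃ δ₀ : ℝ, 0 < δ₀ ∧ ∀ (r : ℕ) (a : ℝ), 0 < a → ∃ n₀ : ℕ, ∀ (p : unitInterval) (n : ℕ), n₀ ≤ n →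
    a ≤ (μ p).real (armAt r (0 : Site 3)) →
    1 - δ₀ ≤ (μ p).real (Hegemonic n r) → 0 < theta (zdGraph 3) (0 : Site 3) p

/-- **(A3, composition).**  `H∞ ⇒ θ(p_c) = 0`: by A1 a jump gives `P_{p_c}(Heg) → 1`; `Heg(n,r)`
is a local event, so its probability is continuous in `p` and exceeds `1 − δ₀` at some
`p < p_c`, where A2 gives `θ(p) > 0` — contradicting the definition of `p_c`. -/
def CardA_closes : Prop := TwoSpanningSublinear → _root_.PercolationContinuityZ3

/-- **(A4, provable now).**  Continuity implies the crux (`τ_{p_c}(0,x) → 0` by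
`percolationContinuityZ3_iff_tendsto_tau`, `in-box ⊆ bulk`, Cesàro in both variables). -/
def CardA_crux : Prop := _root_.PercolationContinuityZ3 → Crux

/-! ## Card B — critical-quantile-ladder -/

/-- Free-box cluster size of `x` in `Λ_n` (only in-box open paths count). -/
def freeSize (n : ℕ) (ω : BondConfig (Site 3)) (x : Site 3) : ℕ :=
  ((box 3 n).filter fun v => ω ∈ openConnIn (↑(box 3 n) : Set (Site 3)) x v).card

/-- Largest free-box cluster `|K_max^free(Λ_n)|`. -/
def freeMax (n : ℕ) (ω : BondConfig (Site 3)) : ℕ := (box 3 n).sup (freeSize n ω)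

/-- Hutchcroft's typical value `M_n(p) = min{m : P_p(|K_max^free(Λ_n)| ≥ m) ≤ e⁻¹}` (the
`1/e`-quantile ladder variable; cf. `typicalMax` of UniversalTightness.lean, here for the
free box, i.e. for the product measure restricted to the edges of `Λ_n`). -/
def freeTypicalMax (p : unitInterval) (n : ℕ) : ℕ :=
  sInf {m : ℕ | (μ p).real {ω | m ≤ freeMax n ω} ≤ Real.exp (-1)}

/-- **The coherence event** `Coh(N, n, t)`: any two vertices of `Λ_N` whose free clusters in
their OWN centred boxes of radius `2n` have at least `t` vertices are joined inside
`Λ_{N+2n}`.  (Stronger than the partition form used in the ladder, hence sufficient.) -/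
def Cohere (N n t : ℕ) : Set (BondConfig (Site 3)) :=
  {ω | ∀ x ∈ box 3 N, ∀ x' ∈ box 3 N,
      t ≤ ((box 3 N).filter fun v => ω ∈ openConnIn {u | u - x ∈ box 3 (2 * n)} x v).card →
      t ≤ ((box 3 N).filter fun v => ω ∈ openConnIn {u | u - x' ∈ box 3 (2 * n)} x' v).card →
      ω ∈ openConnIn (↑(box 3 (N + 2 * n)) : Set (Site 3)) x x'}

/-- **(B, target form C⁺) SuperFractalCoherence.**  At ONE scale ratio `L ≥ 2^24`, for every
`p ≤ p_c` and all large `m` in the super-fractal regime `M_m(p) ≥ m^{2.8}` (vacuous in the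
real world, where `M_m(p_c) ≍ m^{2.52}`), coherence of the typical sub-box clusters holds with
probability at least `1/2`. -/
def SuperFractalCoherence : Prop :=
  ∃ L : ℕ, 2 ^ 24 ≤ L ∧ ∃ m₀ : ℕ, ∀ p : unitInterval, p ≤ criticalProbI 3 → ∀ m : ℕ, m₀ ≤ m →
    (m : ℝ) ^ (2.8 : ℝ) ≤ (freeTypicalMax p m : ℝ) →
      (1 : ℝ) / 2 ≤ (μ p).real (Cohere (L * m) m (freeTypicalMax p m / 2))

/-- **Subcritical sharpness input** (Menshikov / Aizenman–Barsky; a Literature fact): below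
`p_c` the free-box susceptibilities are bounded uniformly in the box. -/
def SubcriticalFreeSusceptibilityBounded : Prop :=
  ∀ p : unitInterval, p < criticalProbI 3 → ∃ C : ℝ, ∀ n : ℕ, ∀ x ∈ box 3 n,
    (∑ v ∈ box 3 n, (μ p).real (openConnIn (↑(box 3 n) : Set (Site 3)) x v)) ≤ C

/-- **(B1, the ladder step, provable now given C⁺).**  In the regime, coherence with
probability `≥ 1/2` propagates the typical value: `M_{(L+2)m}(p) ≥ (L³/16)·M_m(p)` (binomial
count of the `≥ (L-1)³/4` disjoint translates of `Λ_m` inside `Λ_{Lm}` with a free cluster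
`≥ M_m/2`, probability `≥ 9/10`; on `Cohere (L*m) m (M_m/2)` they are one cluster of
`Λ_{Lm+2m} ⊆ Λ_{(L+2)m}`; `9/10 − 1/2 > e⁻¹`).  Scale ratio per step `L+2`; regime maintenance
`L³/16 ≥ (L+2)^{2.8}` holds for `L ≥ 2^24`. -/
def CardB_step1 : Prop :=
  SuperFractalCoherence → ∃ L : ℕ, 2 ^ 24 ≤ L ∧ ∃ m₀ : ℕ, ∀ p : unitInterval,
    p ≤ criticalProbI 3 → ∀ m : ℕ, m₀ ≤ m → (m : ℝ) ^ (2.8 : ℝ) ≤ (freeTypicalMax p m : ℝ) →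
      (L : ℝ) ^ 3 / 16 * (freeTypicalMax p m : ℝ) ≤ (freeTypicalMax p ((L + 2) * m) : ℝ)

/-- **(B2, composition).**  Ladder + sharpness + continuity of `p ↦ P_p(m ≤ freeMax n)` at fixed
`n` + the BK upper tail `E|K_max^free| ≤ 4·M_n` (`integral_clusterMaxIn_le_four_mul_typicalMax`)
give the crux, and in fact a power saving `FA₂(n) ≤ C n^{-1/5}` (FreeBoxPowerSaving). -/
def CardB_closes : Prop :=
  SuperFractalCoherence → SubcriticalFreeSusceptibilityBounded → Crux

def CardB_powerSaving : Prop :=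
  SuperFractalCoherence → SubcriticalFreeSusceptibilityBounded →
    Summit.CriticalPhenomena.PercolationContinuityZ3.Theses.PercNonProliferation.FreeBoxPowerSaving

/-- **(B0, zero-one law for free giants, provable now — BK splitting
`P(|K_max| ≥ 3t) ≤ P(|K_max| ≥ t)²`, tree: `prodBernoulli_real_clusterMaxIn_ge_mul_le`).**
Either free `δ`-giants have probability `→ 0` for every `δ` (the crux), or for every `ε` there
is `δ > 0` with free `δ`-giants of probability `≥ 1 − ε` along a subsequence. -/
def FreeGiantZeroOne : Prop :=
  (∀ δ : ℝ, 0 < δ → Tendsto (fun n : ℕ =>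
      (μc).real {ω | δ * ((box 3 n).card : ℝ) ≤ (freeMax n ω : ℝ)}) atTop (nhds 0)) ∨
  (∀ ε : ℝ, 0 < ε → ∃ δ : ℝ, 0 < δ ∧ ∃ᶠ n : ℕ in atTop,
      1 - ε ≤ (μc).real {ω | δ * ((box 3 n).card : ℝ) ≤ (freeMax n ω : ℝ)})

end

end Summit.CriticalPhenomena.PercolationContinuityZ3.Cruxes.FreeBoxSparse.Sketch
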